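import Summits.AnomalousDissipation.AnomalousDissipation.Theses.TwoAndHalfD
import Literature.Analysis.FluidPDE.PassiveScalarWellPosednessProofs
import Literature.Analysis.FluidPDE.PassiveScalarClassicalEnergy

/-!
# Cold-start variance bound for the sourced passive scalar — toolkit (linear-PDE plumbing)

Support file for the stub `stub_coldStartVariance` (S2) of the line `budgeted-mixer-template` for
the crux `TwoAndHalfD.ScalarAnomalySteadySourceFormal` (stmt-AnomalousDissipation-0448). It
collects the elementary calculus of classical solutions of the forced advection–diffusion equation
`∂ₜθ + u·∇θ = κΔθ + s`, `div u = 0`, on `S × T^d` (`Torus.IsClassicalScalarTransportForcedOn`),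
all proved from the tree's classical passive-scalar API (`PassiveScalarClassicalEnergy`,
`PassiveScalarWellPosednessProofs`):

* `forced_restrict` — restriction of the time set (forced twin of
  `IsClassicalScalarTransportOn.restrict`);
* `forced_sub_unforced` — linearity: forced minus unforced is forced (twin of
  `IsClassicalScalarTransportForcedOn.sub`);
* `forced_hasDerivWithinAt_scalarL2Sq` — the sourced `L²` balance
  `d/dt ‖θ(t)‖² = -2κ‖∇θ(t)‖² + 2∫ θ s` within a convex time set (forced twin of
  `hasDerivWithinAt_scalarL2Sq_holds`; DEIJ 2022, (1.2); Doering–Foias 2002, §2);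
* `integral_mul_le_sqrt_mul_sqrt`, `sqrt_integral_add_sq_le` — Cauchy–Schwarz and Minkowski in
  `L²(T^d)` in the `Real.sqrt` form used by the restart argument;
* `sqrt_scalarL2Sq_le_of_coldStart` — **the cold-start estimate**: a classical solution of the
  `h`-sourced equation on `[a, b]` (`κ ≥ 0`) issued from the zero datum at `a` has
  `‖ρ(t)‖_{L²} ≤ (t - a)‖h‖_{L²}` (balance + Cauchy–Schwarz give `(‖ρ‖²)' ≤ 2‖h‖‖ρ‖`; an
  `ε`-regularised square root is then `‖h‖`-Lipschitz from `ε` at `a`, Mathlib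
  `antitoneOn_of_hasDerivWithinAt_nonpos`; let `ε → 0`);
* `stub_coldStartVariance_toolkit` — the same estimate on `T²` in closed `∀`-form, the registered
  sub-goal under which this toolkit lands.

Supports stmt-AnomalousDissipation-0448. [folklore: Shaw–Thiffeault–Doering 2007 (I.11);
Doering–Foias 2002 §2]
-/

-- the summit path `AnomalousDissipation/AnomalousDissipation` duplicates a namespace component
set_option linter.dupNamespace false

noncomputable section

namespace Summit.AnomalousDissipation.AnomalousDissipation.Theorems.ScalarAnomalySteadySourceFormal.ColdStartVariance

open MeasureTheory Filter Topology Set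
open scoped ENNReal NNReal InnerProductSpace ContDiff
open Literature.Analysis.FunctionSpaces Literature.Analysis.FluidPDE

variable {d : Type*} [Fintype d] [DecidableEq d]

/-! ## Restriction and linearity -/

section Linear

variable {S S' : Set ℝ} {κ : ℝ} {u : ℝ → UnitAddTorus d → EuclideanSpace ℝ d}
  {s θ φ : ℝ → UnitAddTorus d → ℝ}

/-- **Restriction of the time set** for classical forced solutions: a classical solution of
`∂ₜθ + u·∇θ = κΔθ + s` on `S` is one on every `S' ⊆ S` of unique differentiability (the one-sided
time derivatives within `S` and `S'` agree on `S'`; forced twin of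
`IsClassicalScalarTransportOn.restrict`). [folklore] -/
theorem forced_restrict (h : Torus.IsClassicalScalarTransportForcedOn S κ u s θ) (hS' : S' ⊆ S)
    (hU : UniqueDiffOn ℝ S') : Torus.IsClassicalScalarTransportForcedOn S' κ u s θ where
  smooth_velocity := h.smooth_velocity.mono hS'
  smooth_source := h.smooth_source.mono hS'
  smooth_scalar := h.smooth_scalar.mono hS'
  transport t ht x := by
    have hd : Torus.timeDerivWithin S' θ t x = Torus.timeDerivWithin S θ t x :=
      ((h.smooth_scalar.hasDerivWithinAt_slice (hS' ht) x).mono hS').derivWithin (hU t ht)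
    rw [hd]
    exact h.transport t (hS' ht) x
  divFree t ht := h.divFree t (hS' ht)

/-- **Linearity**: a classical forced solution minus a classical unforced solution (same drift,
same diffusivity, same time set of unique differentiability) is a classical forced solution with
the same source (twin of `IsClassicalScalarTransportForcedOn.sub`). [folklore] -/
theorem forced_sub_unforced (hU : UniqueDiffOn ℝ S)
    (h₁ : Torus.IsClassicalScalarTransportForcedOn S κ u s θ)
    (h₂ : Torus.IsClassicalScalarTransportOn S κ u φ) :
    Torus.IsClassicalScalarTransportForcedOn S κ u s (fun t x => θ t x - φ t x) := by
  refine ⟨h₁.smooth_velocity, h₁.smooth_source, h₁.smooth_scalar.sub h₂.smooth_scalar,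
    fun t ht x => ?_, h₁.divFree⟩
  have h1t : Torus.IsSmooth (θ t) := h₁.smooth_scalar.isSmooth_slice ht
  have h2t : Torus.IsSmooth (φ t) := h₂.smooth_scalar.isSmooth_slice ht
  have hdt : Torus.timeDerivWithin S (fun t x => θ t x - φ t x) t x =
      Torus.timeDerivWithin S θ t x - Torus.timeDerivWithin S φ t x :=
    ((h₁.smooth_scalar.hasDerivWithinAt_slice ht x).sub
      (h₂.smooth_scalar.hasDerivWithinAt_slice ht x)).derivWithin (hU t ht)
  have h12 : Torus.IsSmooth (fun y => θ t y - φ t y) := h1t.sub h2t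
  have hgrad : ⟪u t x, Torus.gradient (fun y => θ t y - φ t y) x⟫_ℝ =
      ⟪u t x, Torus.gradient (θ t) x⟫_ℝ - ⟪u t x, Torus.gradient (φ t) x⟫_ℝ := by
    rw [Torus.inner_gradient_eq_sum_mul_partialDeriv (h12.isContDiff (by simp)),
      Torus.inner_gradient_eq_sum_mul_partialDeriv (h1t.isContDiff (by simp)),
      Torus.inner_gradient_eq_sum_mul_partialDeriv (h2t.isContDiff (by simp)),
      ← Finset.sum_sub_distrib]
    refine Finset.sum_congr rfl fun j _ => ?_
    rw [Torus.partialDeriv_sub' h1t h2t, mul_sub]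
  have hlap : Torus.laplacian (fun y => θ t y - φ t y) x =
      Torus.laplacian (θ t) x - Torus.laplacian (φ t) x := Torus.laplacian_sub' h1t h2t x
  have e1 := h₁.transport t ht x
  have e2 := h₂.transport t ht x
  rw [hdt, hgrad, hlap]
  linear_combination e1 - e2

end Linear

/-! ## The sourced `L²` balance -/

section Balance

variable {S : Set ℝ} {κ : ℝ} {u : ℝ → UnitAddTorus d → EuclideanSpace ℝ d}
  {s θ : ℝ → UnitAddTorus d → ℝ}

/-- **The sourced `L²` balance.** For a classical solution of `∂ₜθ + u·∇θ = κΔθ + s` on a convex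
time set `S`, `d/dt ‖θ(t)‖²_{L²} = -2κ‖∇θ(t)‖²_{L²} + 2∫ θ(t) s(t)` within `S` (multiply the
equation by `θ` and integrate over `T^d`: the transport term vanishes by incompressibility,
`∫ θΔθ = -‖∇θ‖²`; forced twin of `IsClassicalScalarTransportOn.hasDerivWithinAt_scalarL2Sq_holds`;
DEIJ 2022, (1.2) with a source; Doering–Foias 2002, §2: power input = `∫ θ s`). At an isolated
point of `S` the statement is vacuous. [folklore] -/
theorem forced_hasDerivWithinAt_scalarL2Sq (h : Torus.IsClassicalScalarTransportForcedOn S κ u s θ)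
    (hS : Convex ℝ S) {t : ℝ} (ht : t ∈ S) :
    HasDerivWithinAt (fun τ => Torus.scalarL2Sq (θ τ))
      (-(2 * κ) * Torus.scalarGradNormSq (θ t) + 2 * ∫ x, θ t x * s t x) S t := by
  by_cases hacc : AccPt t (𝓟 S)
  swap
  · exact HasFDerivWithinAt.of_not_accPt hacc
  have hU : UniqueDiffOn ℝ S :=
    uniqueDiffOn_convex hS (Torus.interior_nonempty_of_convex_of_accPt hS ht hacc)
  have hθs := h.smooth_scalar
  have hθt : Torus.IsSmooth (θ t) := hθs.isSmooth_slice ht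
  have hut : Torus.IsSmooth (u t) := h.smooth_velocity.isSmooth_slice ht
  have hst : Torus.IsSmooth (s t) := h.smooth_source.isSmooth_slice ht
  -- differentiate `∫ θ²` under the integral sign
  have hφ : Torus.IsSmoothSpaceTimeOn S (fun τ x => θ τ x * θ τ x) := hθs.mul hθs
  have hE := hφ.hasDerivWithinAt_integral hS ht
  have htd : ∀ x, Torus.timeDerivWithin S (fun τ x => θ τ x * θ τ x) t x =
      2 * (θ t x * Torus.timeDerivWithin S θ t x) := by
    intro x
    have h2 : HasDerivWithinAt (fun τ => θ τ x * θ τ x)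
        (Torus.timeDerivWithin S θ t x * θ t x + θ t x * Torus.timeDerivWithin S θ t x) S t :=
      (hθs.hasDerivWithinAt_slice ht x).mul (hθs.hasDerivWithinAt_slice ht x)
    rw [Torus.timeDerivWithin, h2.derivWithin (hU t ht)]
    ring
  have hfun : (fun τ => Torus.scalarL2Sq (θ τ)) = fun τ => ∫ x, θ τ x * θ τ x := by
    funext τ
    simp only [Torus.scalarL2Sq, sq]
  rw [hfun]
  refine hE.congr_deriv ?_
  -- evaluate `∫ 2 θ ∂ₜθ` with the equation and the two integrations by parts
  have hpt : (fun x => Torus.timeDerivWithin S (fun τ x => θ τ x * θ τ x) t x) =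
      fun x => 2 * (κ * (θ t x * Torus.laplacian (θ t) x) -
        θ t x * ⟪u t x, Torus.gradient (θ t) x⟫_ℝ + θ t x * s t x) := by
    funext x
    rw [htd x]
    have := h.transport t ht x
    have hre : Torus.timeDerivWithin S θ t x = κ * Torus.laplacian (θ t) x -
        ⟪u t x, Torus.gradient (θ t) x⟫_ℝ + s t x := by linarith
    rw [hre]
    ring
  have i1 : Integrable (fun x => θ t x * Torus.laplacian (θ t) x) volume :=
    (hθt.smul' hθt.laplacian).integrable
  have i2 : Integrable (fun x => θ t x * ⟪u t x, Torus.gradient (θ t) x⟫_ℝ) volume :=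
    (hθt.smul' (hut.inner hθt.gradient)).integrable
  have i3 : Integrable (fun x => θ t x * s t x) volume := (hθt.smul' hst).integrable
  have i12 : Integrable (fun x => κ * (θ t x * Torus.laplacian (θ t) x) -
      θ t x * ⟪u t x, Torus.gradient (θ t) x⟫_ℝ) volume := (i1.const_mul κ).sub i2
  rw [hpt, integral_const_mul, integral_add i12 i3,
    integral_sub (i1.const_mul κ) i2, integral_const_mul,
    Torus.integral_mul_laplacian_self_eq_neg_scalarGradNormSq hθt,
    Torus.integral_mul_inner_gradient_self_eq_zero hut (h.divFree t ht) hθt]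
  ring

end Balance

/-! ## Cauchy–Schwarz and Minkowski in `L²(T^d)` -/

section Inequalities

omit [DecidableEq d] in
/-- **Cauchy–Schwarz** in `L²(T^d)`: `∫ f g ≤ (∫ f²)^{1/2} (∫ g²)^{1/2}` (Hölder with
`p = q = 2`, Mathlib `integral_mul_norm_le_Lp_mul_Lq`). [folklore] -/
theorem integral_mul_le_sqrt_mul_sqrt {f g : UnitAddTorus d → ℝ} (hf : MemLp f 2 volume)
    (hg : MemLp g 2 volume) :
    ∫ x, f x * g x ≤ √(∫ x, f x ^ 2) * √(∫ x, g x ^ 2) := by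
  have h := integral_mul_norm_le_Lp_mul_Lq (μ := volume) (f := fun x => ‖f x‖) (g := fun x => ‖g x‖)
    Real.HolderConjugate.two_two (by simpa using hf.norm) (by simpa using hg.norm)
  simp only [norm_norm, Real.rpow_two, one_div, Real.sqrt_eq_rpow] at h ⊢
  simp only [Real.norm_eq_abs, sq_abs] at h
  refine le_trans ?_ h
  refine (le_abs_self _).trans ((abs_integral_le_integral_abs).trans (le_of_eq ?_))
  exact integral_congr_ae (Eventually.of_forall fun x => abs_mul _ _)

omit [DecidableEq d] in
/-- **Minkowski** in `L²(T^d)` for continuous functions, `Real.sqrt` form: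
`(∫ (f + g)²)^{1/2} ≤ (∫ f²)^{1/2} + (∫ g²)^{1/2}` (expand the square and use Cauchy–Schwarz).
[folklore] -/
theorem sqrt_integral_add_sq_le {f g : UnitAddTorus d → ℝ} (hf : Continuous f) (hg : Continuous g) :
    √(∫ x, (f x + g x) ^ 2) ≤ √(∫ x, f x ^ 2) + √(∫ x, g x ^ 2) := by
  set A := √(∫ x, f x ^ 2) with hA_def
  set B := √(∫ x, g x ^ 2) with hB_def
  have hA : 0 ≤ A := Real.sqrt_nonneg _
  have hB : 0 ≤ B := Real.sqrt_nonneg _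
  have hfm : MemLp f 2 volume :=
    hf.memLp_of_hasCompactSupport (HasCompactSupport.of_compactSpace f)
  have hgm : MemLp g 2 volume :=
    hg.memLp_of_hasCompactSupport (HasCompactSupport.of_compactSpace g)
  have hcs : ∫ x, f x * g x ≤ A * B := integral_mul_le_sqrt_mul_sqrt hfm hgm
  have i1 : Integrable (fun x => f x ^ 2) volume := (hf.pow 2).integrable_unitAddTorus
  have i2 : Integrable (fun x => 2 * (f x * g x)) volume :=
    (continuous_const.mul (hf.mul hg)).integrable_unitAddTorus
  have i3 : Integrable (fun x => g x ^ 2) volume := (hg.pow 2).integrable_unitAddTorus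
  have hexp : ∫ x, (f x + g x) ^ 2 = (∫ x, f x ^ 2) + 2 * (∫ x, f x * g x) + ∫ x, g x ^ 2 := by
    have e : ∀ x, (f x + g x) ^ 2 = (f x ^ 2 + 2 * (f x * g x)) + g x ^ 2 := fun x => by ring
    have i12 : Integrable (fun x => f x ^ 2 + 2 * (f x * g x)) volume := i1.add i2
    simp_rw [e]
    rw [integral_add i12 i3, integral_add i1 i2, integral_const_mul]
  have hf2 : ∫ x, f x ^ 2 = A ^ 2 := (Real.sq_sqrt (integral_nonneg fun x => sq_nonneg _)).symm
  have hg2 : ∫ x, g x ^ 2 = B ^ 2 := (Real.sq_sqrt (integral_nonneg fun x => sq_nonneg _)).symm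
  rw [Real.sqrt_le_left (add_nonneg hA hB), hexp, hf2, hg2]
  nlinarith

end Inequalities

/-! ## The cold-start estimate -/

section ColdStart

variable {a b κ : ℝ} {u : ℝ → UnitAddTorus d → EuclideanSpace ℝ d} {hsrc : UnitAddTorus d → ℝ}
  {ρ : ℝ → UnitAddTorus d → ℝ}

/-- **Cold-start estimate.** A classical solution `ρ` of `∂ₜρ + u·∇ρ = κΔρ + h` on `[a, b] × T^d`
(`κ ≥ 0`, `a < b`, steady smooth source `h`) with `ρ(a) = 0` obeys
`‖ρ(t)‖_{L²} ≤ (t - a) ‖h‖_{L²}` for `t ∈ [a, b]`: by the sourced balance and Cauchy–Schwarz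
`(‖ρ‖²)' ≤ 2‖h‖‖ρ‖`, so for every `ε > 0` the function `t ↦ (‖ρ(t)‖² + ε²)^{1/2} - (t - a)‖h‖` is
non-increasing on `[a, b]` (Mathlib `antitoneOn_of_hasDerivWithinAt_nonpos`), whence
`‖ρ(t)‖ ≤ ε + (t - a)‖h‖`; let `ε → 0`. (Shaw–Thiffeault–Doering 2007, (I.11): the variance of a
sourced scalar grows at most linearly from a cold start.) [folklore] -/
theorem sqrt_scalarL2Sq_le_of_coldStart (hκ : 0 ≤ κ) (hab : a < b)
    (h : Torus.IsClassicalScalarTransportForcedOn (Icc a b) κ u (fun _ => hsrc) ρ)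
    (h0 : ρ a = fun _ => 0) {t : ℝ} (ht : t ∈ Icc a b) :
    √(Torus.scalarL2Sq (ρ t)) ≤ (t - a) * √(Torus.scalarL2Sq hsrc) := by
  set H := √(Torus.scalarL2Sq hsrc) with hH_def
  set L : ℝ → ℝ := fun τ => Torus.scalarL2Sq (ρ τ) with hL_def
  have hconv : Convex ℝ (Icc a b) := convex_Icc a b
  have hsm : Torus.IsSmooth hsrc := h.smooth_source.isSmooth_slice (left_mem_Icc.2 hab.le)
  have hH : 0 ≤ H := Real.sqrt_nonneg _
  have hLnn : ∀ τ, 0 ≤ L τ := fun τ => Torus.scalarL2Sq_nonneg _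
  -- the balance and the Cauchy–Schwarz bound on its right-hand side
  set D : ℝ → ℝ := fun τ => -(2 * κ) * Torus.scalarGradNormSq (ρ τ) + 2 * ∫ x, ρ τ x * hsrc x
    with hD_def
  have hder : ∀ τ ∈ Icc a b, HasDerivWithinAt L (D τ) (Icc a b) τ := fun τ hτ =>
    forced_hasDerivWithinAt_scalarL2Sq h hconv hτ
  have hbound : ∀ τ ∈ Icc a b, D τ ≤ 2 * H * √(L τ) := by
    intro τ hτ
    have hρτ : Torus.IsSmooth (ρ τ) := h.smooth_scalar.isSmooth_slice hτ
    have hcs : ∫ x, ρ τ x * hsrc x ≤ √(L τ) * H :=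
      integral_mul_le_sqrt_mul_sqrt (hρτ.memLp 2) (hsm.memLp 2)
    have hnn : 0 ≤ 2 * κ * Torus.scalarGradNormSq (ρ τ) :=
      mul_nonneg (mul_nonneg two_pos.le hκ) (Torus.scalarGradNormSq_nonneg _)
    simp only [hD_def]
    nlinarith
  have hLcont : ContinuousOn L (Icc a b) := fun τ hτ => (hder τ hτ).continuousWithinAt
  have hL0 : L a = 0 := by simp [hL_def, h0, Torus.scalarL2Sq]
  -- `ε`-regularisation of the square root
  refine le_of_forall_pos_le_add fun ε hε => ?_
  set G : ℝ → ℝ := fun τ => √(L τ + ε ^ 2) - (τ - a) * H with hG_def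
  have hGcont : ContinuousOn G (Icc a b) :=
    ((hLcont.add continuousOn_const).sqrt).sub
      ((continuousOn_id.sub continuousOn_const).mul continuousOn_const)
  have hGder : ∀ x ∈ interior (Icc a b),
      HasDerivWithinAt G (D x / (2 * √(L x + ε ^ 2)) - H) (interior (Icc a b)) x := by
    intro x hx
    rw [interior_Icc] at hx ⊢
    have hxI : x ∈ Icc a b := Ioo_subset_Icc_self hx
    have hne : L x + ε ^ 2 ≠ 0 := (add_pos_of_nonneg_of_pos (hLnn x) (pow_pos hε 2)).ne'
    have h1 : HasDerivWithinAt (fun τ => L τ + ε ^ 2) (D x) (Icc a b) x :=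
      (hder x hxI).add_const (ε ^ 2)
    have h2 := h1.sqrt hne
    have h3 : HasDerivWithinAt (fun τ => (τ - a) * H) (1 * H) (Icc a b) x :=
      ((hasDerivWithinAt_id x _).sub_const a).mul_const H
    have h4 := (h2.sub h3).mono Ioo_subset_Icc_self
    rw [one_mul] at h4
    exact h4
  have hGnonpos : ∀ x ∈ interior (Icc a b), D x / (2 * √(L x + ε ^ 2)) - H ≤ 0 := by
    intro x hx
    rw [interior_Icc] at hx
    have hxI : x ∈ Icc a b := Ioo_subset_Icc_self hx
    have hpos : 0 < 2 * √(L x + ε ^ 2) :=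
      mul_pos two_pos (Real.sqrt_pos.2 (add_pos_of_nonneg_of_pos (hLnn x) (pow_pos hε 2)))
    have hmono : √(L x) ≤ √(L x + ε ^ 2) := Real.sqrt_le_sqrt (by nlinarith)
    rw [sub_nonpos, div_le_iff₀ hpos]
    nlinarith [hbound x hxI]
  have hanti := antitoneOn_of_hasDerivWithinAt_nonpos hconv hGcont hGder hGnonpos
  have hGa : G a = ε := by
    simp only [hG_def, hL0, zero_add, sub_self, zero_mul, sub_zero]
    exact Real.sqrt_sq hε.le
  have hle : G t ≤ G a := hanti (left_mem_Icc.2 hab.le) ht ht.1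
  rw [hGa] at hle
  have hmono : √(L t) ≤ √(L t + ε ^ 2) := Real.sqrt_le_sqrt (by nlinarith)
  simp only [hG_def] at hle
  linarith

end ColdStart

/-! ## Registered form of the toolkit's deciding estimate -/

/-- **The cold-start estimate, registered form** (sub-goal `stub_coldStartVariance_toolkit` of
stmt-AnomalousDissipation-0448, serving stub S2 `stub_coldStartVariance` of the line
`budgeted-mixer-template`): on `T²`, a classical solution `ρ` of `∂ₜρ + u·∇ρ = κΔρ + h` on
`[a, b]` (`κ ≥ 0`, `a < b`) with `ρ(a) = 0` has `‖ρ(t)‖_{L²} ≤ (t - a)‖h‖_{L²}` for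
`t ∈ [a, b]` (`sqrt_scalarL2Sq_le_of_coldStart`). [folklore] -/
theorem stub_coldStartVariance_toolkit :
    ∀ (a b κ : ℝ) (u : ℝ → UnitAddTorus (Fin 2) → EuclideanSpace ℝ (Fin 2))
      (h : UnitAddTorus (Fin 2) → ℝ) (ρ : ℝ → UnitAddTorus (Fin 2) → ℝ),
      0 ≤ κ → a < b →
      Torus.IsClassicalScalarTransportForcedOn (Set.Icc a b) κ u (fun _ => h) ρ →
      ρ a = (fun _ => (0 : ℝ)) →
      ∀ t ∈ Set.Icc a b,
        Real.sqrt (Torus.scalarL2Sq (ρ t)) ≤ (t - a) * Real.sqrt (Torus.scalarL2Sq h) :=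
  fun _ _ _ _ _ _ hκ hab hρ h0 _ ht => sqrt_scalarL2Sq_le_of_coldStart hκ hab hρ h0 ht

end Summit.AnomalousDissipation.AnomalousDissipation.Theorems.ScalarAnomalySteadySourceFormal.ColdStartVariance

end
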